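import Literature.AlgebraicGeometry.Motives.IntegralModelTameQuotientDescendedAction
import Literature.AlgebraicGeometry.ShimuraVarieties.UnitaryShimuraCurveLevelQuotientAction
import Literature.AlgebraicGeometry.Motives.VarietiesProperProofs
import HarnessLib

/-!
# Crux `HLiu418` — P6 sub-line **F0-P6a ModuliDatum**, letter GALQ `RecordGaloisQuotientDescent` PAID

Cell `hodgecm-mathlib`, P6 «MOD programme», LEAD F0P6-plan ruling M-2c (2026-09-01T13:40:13Z) «DEAL GALQ»: the tame Galois-quotient
step of the moduli core — line `Cruxes/HLiu418/Lines/F0_P6a_ModuliDatum.lean` (F0P6a-plan (g0), ED. 1 cand 009ad706a2de2985, registered stub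
`stub_GALQ : RecordGaloisQuotientDescent`).  This file proves THE TEXT OF `RecordGaloisQuotientDescent` VERBATIM (same binders) as the
theorem `galq_holds`, so that the desk folds `stub_GALQ := F0P6aStubGALQ.galq_holds` BY NAME.  The proof is one application of the ★
Literature organ `IntegralModel.exists_tameQuotient_descAction` (`Motives/IntegralModelTameQuotientDescendedAction.lean`: the quotient
`𝓨 ∕ Γ` is a smooth proper model of `M⋆_{Kc}` — ★ A-p14 `exists_tameQuotient_isSmoothProper_one`'s engine: SGA 1 V 1.9 ∕ 1.5, Katz–Mazur
A7.1 — carrying the DESCENDED level action ★ `ActionOver.descAction` with its stable affine cover and generic reading), the generic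
reading of `ρ (φ k)` being the record translate `T_{k⁻¹}` by the hypothesis `(1, φ k) ↦ T_{k⁻¹}` on `Y`.  `M⋆_{Kc}` is separated over `F`
(projective, record (F1)).  HC_CM is proved only modulo the printed citations until rung 0 closes; nothing here is about HC: it discharges
one registered stub of the P6a line.
-/

set_option autoImplicit false

-- `Summit.HodgeConjecture.HodgeConjecture.…` repeats `HodgeConjecture` by design (D-0017); the lakefile turns `linter.dupNamespace`
-- off tree-wide (weak option), restated here so stand-alone elaboration is warning-free.
set_option linter.dupNamespace false

noncomputable section

open CategoryTheory NumberField IsDedekindDomain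
open scoped Matrix
open Literature.NumberTheory.Automorphic Literature.NumberTheory.Automorphic.UnitaryGroup
open Literature.AlgebraicGeometry.ShimuraVarieties.UnitaryCanonicalModel
open Literature.NumberTheory.Automorphic.Liu2021.AppendixC
open Literature.AlgebraicGeometry.Motives (IntegralModel SchemeOver)
open Literature.AlgebraicGeometry.RelativeSpec (ActionOver)
open Literature.NumberTheory.EllipticCurves (genericFibre)

namespace Summit.HodgeConjecture.HodgeConjecture.Cruxes.HLiu418.F0P6aStubGALQ

set_option maxHeartbeats 800000 in
/-- **LETTER GALQ — `RecordGaloisQuotientDescent` HOLDS** (the text of `F0P6aModuliDatum.RecordGaloisQuotientDescent` verbatim): for a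
record datum, small levels `Kc ≤ K` with `Kc` normalised by `K`, the level group `G` (`φ : K ↠ G`, `ker φ = Kc`), an `F`-scheme `Y` over
`M⋆_{Kc}` with an action `τ` of `Γ × G` (`|Γ|` invertible in `𝒪_{F,(w)}`) such that `π : Y → M⋆_{Kc}` is a geometric quotient by `Γ` and
`(1, φ k)` covers `T_{k⁻¹}`, and a smooth proper model `𝓨` of `Y` over `𝒪_{F,(w)}` with an action `θ` of `Γ × G` (generic fibre `τ`, stable
affine cover): the tame quotient `𝒮c := 𝓨 ∕ Γ` is a smooth proper model of `M⋆_{Kc}`, the `G`-action descends to `ρ` on `𝒮c` with a stable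
affine cover and generic fibre `k ↦ T_{k⁻¹}`, and `πq : 𝓨 → 𝒮c` has generic fibre `π`.  Proof: ★ `IntegralModel.exists_tameQuotient_descAction`.
[cite: SGA1, Exp. V Prop. 1.8, Prop. 1.9, Cor. 1.5] [cite: KatzMazur1985, A7.1] [cite: MumfordAV1970, §7 Thm. p. 66] -/
theorem galq_holds :
  ∀ (F : Type) [Field F] [NumberField F] [IsCMField F] [IsGalois ℚ F] (ι₁ : F →+* ℂ)
    (Jstar : Matrix (Fin 2) (Fin 2) F)
    (K₀ : C5.OpenCompactSubgroup ↥(finAdelic ↥(maximalRealSubfield F) F (IsCMField.complexConj F) 2 Jstar))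
    (S : RecordSystemGS F Jstar ι₁ K₀) (hU7ₛ : S.HeckeTranslateDefinedOver)
    (_hJ : (Jstar.map (IsCMField.complexConj F))ᵀ = Jstar) (_hJu : IsUnit Jstar) (K : C5.SmallLevel K₀)
    (w : HeightOneSpectrum (𝓞 F))
    (Kc : C5.SmallLevel K₀) (_hKcK : Kc ≤ K) (hn : ∀ k ∈ K.1.1, C5.HeckeLE k Kc Kc)
    (G : Type) [Group G] [Finite G] (φ : ↥K.1.1 →* G) (_hφ : Function.Surjective φ)
    (_hφker : φ.ker = (Kc.1.1 : Subgroup ↥(finAdelic ↥(maximalRealSubfield F) F (IsCMField.complexConj F) 2 Jstar)).subgroupOf K.1.1)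
    (_hcard : IsUnit ((Nat.card G : ℕ) : HeightOneSpectrum.valuationSubringAtPrime F w))
    (Y : SchemeOver F) (π : Y ⟶ S.M.obj Kc)
    (Γ : Type) [Group Γ] [Finite Γ]
    (_hcardΓ : IsUnit ((Nat.card Γ : ℕ) : HeightOneSpectrum.valuationSubringAtPrime F w))
    (τ : ActionOver Y.hom (Γ × G))
    (_hτπ : (⟨τ.aut.comp (MonoidHom.inl Γ G), fun γ => τ.aut_comp (MonoidHom.inl Γ G γ)⟩ : ActionOver Y.hom Γ).IsGeometricQuotient
       π.left)
    (_hτT : ∀ k : ↥K.1.1,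
       (τ.aut (1, φ k)).hom ≫ π.left
         = π.left ≫
             (recordHeckeTranslateGS S hU7ₛ
               ((k : ↥(finAdelic ↥(maximalRealSubfield F) F (IsCMField.complexConj F) 2 Jstar))⁻¹) Kc Kc
               (hn _ (K.1.1.inv_mem k.2))).left)
    (𝓨 : IntegralModel (HeightOneSpectrum.valuationSubringAtPrime F w) F Y) (_h𝓨 : 𝓨.IsSmoothProper 1)
    (θ : ActionOver 𝓨.total.hom (Γ × G))
    (_hcovθ : ∀ y : ↥𝓨.total.left, ∃ O : θ.StableAffineOpens, y ∈ O.1)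
    (_hθ : ∀ a : Γ × G,
       (genericFibre (HeightOneSpectrum.valuationSubringAtPrime F w) F).map (Over.isoMk (θ.aut a) (θ.aut_comp a)).hom
           ≫ 𝓨.genericIso'.hom
         = 𝓨.genericIso'.hom ≫ (Over.isoMk (τ.aut a) (τ.aut_comp a)).hom),
    ∃ (𝒮c : IntegralModel (HeightOneSpectrum.valuationSubringAtPrime F w) F (S.M.obj Kc)) (_h𝒮c : 𝒮c.IsSmoothProper 1)
      (ρ : ActionOver 𝒮c.total.hom G)
      (_hcov : ∀ x : ↥𝒮c.total.left, ∃ O : ρ.StableAffineOpens, x ∈ O.1)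
      (_hρ : ∀ k : ↥K.1.1,
         (genericFibre (HeightOneSpectrum.valuationSubringAtPrime F w) F).map (Over.isoMk (ρ.aut (φ k)) (ρ.aut_comp (φ k))).hom
             ≫ 𝒮c.genericIso'.hom
           = 𝒮c.genericIso'.hom ≫
               recordHeckeTranslateGS S hU7ₛ
                 ((k : ↥(finAdelic ↥(maximalRealSubfield F) F (IsCMField.complexConj F) 2 Jstar))⁻¹) Kc Kc
                 (hn _ (K.1.1.inv_mem k.2)))
      (πq : 𝓨.total ⟶ 𝒮c.total),
      (genericFibre (HeightOneSpectrum.valuationSubringAtPrime F w) F).map πq ≫ 𝒮c.genericIso'.hom = 𝓨.genericIso'.hom ≫ π := by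
  intro F _ _ _ _ ι₁ Jstar K₀ S hU7ₛ _hJ _hJu K w Kc _hKcK hn G _ _ φ _hφ _hφker _hcard Y π Γ _ _ hcardΓ τ hτπ hτT 𝓨 h𝓨 θ hcovθ hθ
  haveI : AlgebraicGeometry.IsSeparated (S.M.obj Kc).hom := by
    haveI := (S.projective Kc).isProper
    infer_instance
  obtain ⟨𝒮c, h𝒮c, ρ, hcov, πq, -, hsq, hgen⟩ :=
    Literature.AlgebraicGeometry.Motives.IntegralModel.exists_tameQuotient_descAction 𝓨 h𝓨 θ hcovθ hcardΓ τ hθ π hτπ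
  exact ⟨𝒮c, h𝒮c, ρ, hcov, fun k => hgen (φ k) _ (hτT k), πq, hsq⟩

set_option maxHeartbeats 800000 in
/-- **ED. 2 — LETTER GALQ in the form of P6a cand v2 (0fd3fb4ee730ec02), with the `Γ`-INVARIANCE of the quotient map `πq` as the
extra binder `_hπqΓ : ∀ γ, (θ.aut (γ, 1)).hom ≫ πq.left = πq.left`** (LEAD F0P6-plan M-4 (2); the invariance of ★ `gluedMk`, output by
★ `IntegralModel.exists_tameQuotient_descAction_inv`).  Text of `F0P6aModuliDatum.RecordGaloisQuotientDescent` (v2) VERBATIM; fold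
`stub_GALQ := F0P6aStubGALQ.galq_holds_v2`. [cite: SGA1, Exp. V Prop. 1.8, Prop. 1.9, Cor. 1.5] [cite: KatzMazur1985, A7.1] -/
theorem galq_holds_v2 :
  ∀ (F : Type) [Field F] [NumberField F] [IsCMField F] [IsGalois ℚ F] (ι₁ : F →+* ℂ)
    (Jstar : Matrix (Fin 2) (Fin 2) F)
    (K₀ : C5.OpenCompactSubgroup ↥(finAdelic ↥(maximalRealSubfield F) F (IsCMField.complexConj F) 2 Jstar))
    (S : RecordSystemGS F Jstar ι₁ K₀) (hU7ₛ : S.HeckeTranslateDefinedOver)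
    (_hJ : (Jstar.map (IsCMField.complexConj F))ᵀ = Jstar) (_hJu : IsUnit Jstar) (K : C5.SmallLevel K₀)
    (w : HeightOneSpectrum (𝓞 F))
    (Kc : C5.SmallLevel K₀) (_hKcK : Kc ≤ K) (hn : ∀ k ∈ K.1.1, C5.HeckeLE k Kc Kc)
    (G : Type) [Group G] [Finite G] (φ : ↥K.1.1 →* G) (_hφ : Function.Surjective φ)
    (_hφker : φ.ker = (Kc.1.1 : Subgroup ↥(finAdelic ↥(maximalRealSubfield F) F (IsCMField.complexConj F) 2 Jstar)).subgroupOf K.1.1)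
    (_hcard : IsUnit ((Nat.card G : ℕ) : HeightOneSpectrum.valuationSubringAtPrime F w))
    (Y : SchemeOver F) (π : Y ⟶ S.M.obj Kc)
    (Γ : Type) [Group Γ] [Finite Γ]
    (_hcardΓ : IsUnit ((Nat.card Γ : ℕ) : HeightOneSpectrum.valuationSubringAtPrime F w))
    (τ : ActionOver Y.hom (Γ × G))
    (_hτπ : (⟨τ.aut.comp (MonoidHom.inl Γ G), fun γ => τ.aut_comp (MonoidHom.inl Γ G γ)⟩ : ActionOver Y.hom Γ).IsGeometricQuotient
       π.left)
    (_hτT : ∀ k : ↥K.1.1,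
       (τ.aut (1, φ k)).hom ≫ π.left
         = π.left ≫
             (recordHeckeTranslateGS S hU7ₛ
               ((k : ↥(finAdelic ↥(maximalRealSubfield F) F (IsCMField.complexConj F) 2 Jstar))⁻¹) Kc Kc
               (hn _ (K.1.1.inv_mem k.2))).left)
    (𝓨 : IntegralModel (HeightOneSpectrum.valuationSubringAtPrime F w) F Y) (_h𝓨 : 𝓨.IsSmoothProper 1)
    (θ : ActionOver 𝓨.total.hom (Γ × G))
    (_hcovθ : ∀ y : ↥𝓨.total.left, ∃ O : θ.StableAffineOpens, y ∈ O.1)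
    (_hθ : ∀ a : Γ × G,
       (genericFibre (HeightOneSpectrum.valuationSubringAtPrime F w) F).map (Over.isoMk (θ.aut a) (θ.aut_comp a)).hom
           ≫ 𝓨.genericIso'.hom
         = 𝓨.genericIso'.hom ≫ (Over.isoMk (τ.aut a) (τ.aut_comp a)).hom),
    ∃ (𝒮c : IntegralModel (HeightOneSpectrum.valuationSubringAtPrime F w) F (S.M.obj Kc)) (_h𝒮c : 𝒮c.IsSmoothProper 1)
      (ρ : ActionOver 𝒮c.total.hom G)
      (_hcov : ∀ x : ↥𝒮c.total.left, ∃ O : ρ.StableAffineOpens, x ∈ O.1)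
      (_hρ : ∀ k : ↥K.1.1,
         (genericFibre (HeightOneSpectrum.valuationSubringAtPrime F w) F).map (Over.isoMk (ρ.aut (φ k)) (ρ.aut_comp (φ k))).hom
             ≫ 𝒮c.genericIso'.hom
           = 𝒮c.genericIso'.hom ≫
               recordHeckeTranslateGS S hU7ₛ
                 ((k : ↥(finAdelic ↥(maximalRealSubfield F) F (IsCMField.complexConj F) 2 Jstar))⁻¹) Kc Kc
                 (hn _ (K.1.1.inv_mem k.2)))
      (πq : 𝓨.total ⟶ 𝒮c.total) (_hπqΓ : ∀ γ : Γ, (θ.aut (γ, 1)).hom ≫ πq.left = πq.left),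
      (genericFibre (HeightOneSpectrum.valuationSubringAtPrime F w) F).map πq ≫ 𝒮c.genericIso'.hom = 𝓨.genericIso'.hom ≫ π := by
  intro F _ _ _ _ ι₁ Jstar K₀ S hU7ₛ _hJ _hJu K w Kc _hKcK hn G _ _ φ _hφ _hφker _hcard Y π Γ _ _ hcardΓ τ hτπ hτT 𝓨 h𝓨 θ hcovθ hθ
  haveI : AlgebraicGeometry.IsSeparated (S.M.obj Kc).hom := by
    haveI := (S.projective Kc).isProper
    infer_instance
  obtain ⟨𝒮c, h𝒮c, ρ, hcov, πq, hinv, -, hsq, hgen⟩ :=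
    Literature.AlgebraicGeometry.Motives.IntegralModel.exists_tameQuotient_descAction_inv 𝓨 h𝓨 θ hcovθ hcardΓ τ hθ π hτπ
  exact ⟨𝒮c, h𝒮c, ρ, hcov, fun k => hgen (φ k) _ (hτT k), πq, hinv, hsq⟩

end Summit.HodgeConjecture.HodgeConjecture.Cruxes.HLiu418.F0P6aStubGALQ

end
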